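import Mathlib.Algebra.Homology.DerivedCategory.RightDerivedFunctorPlus
import Mathlib.Algebra.Homology.DerivedCategory.ExactFunctor
import Mathlib.CategoryTheory.Shift.Adjunction
import HarnessLib

/-!
# Right derived functors on the bounded-below derived category through the injective model:
# `K⁺(Inj C) ≌ D⁺(C)`, `RF ≅ q ∘ F ∘ U` commutes with the shifts, `RF(E•) ≅ F(I•)` on an injective
# resolution; and exact functors on `D⁺` (Weibel 10.4.8, 10.5.2, 10.5.6)

Layer `Literature/Algebra/Homology` (pure homological algebra; no schemes). Mathlib (Riou, 2026) constructs,
for an additive functor `F : C ⥤ D` between abelian categories with `EnoughInjectives C`, the right derived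
functor `F.rightDerivedFunctorPlus : DerivedCategory.Plus C ⥤ DerivedCategory.Plus D` as the TOTAL right derived
functor of `K⁺(F) ⋙ q` for the injective right-derivability structure
(`Mathlib/Algebra/Homology/DerivedCategory/RightDerivedFunctorPlus`, `…/DerivabilityStructureInjectives`), with
its unit `F.rightDerivedFunctorPlusUnit : K⁺(F) ⋙ q ⟶ q ⋙ RF` an isomorphism on complexes of injectives, and
leaves as a TODO that `RF` is a triangulated functor. This file supplies what the consumers of `Rf_*` on schemes
need beyond that (everything PROVED, 0 named facts, no instances — the `CommShift` structures are `def`s to be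
bound with `letI`):

* §1 `InjectiveObject.derivedPlusModel C : K⁺(Inj C) ⥤ D⁺(C)` (`= K⁺(ι) ⋙ q`) is full, faithful and — with
  enough injectives — essentially surjective, hence an equivalence **`derivedPlusModelEquivalence`** (Weibel
  Thm. 10.4.8 "`D⁺(A) ≅ K⁺(I)`"), commuting with the shifts; its chosen inverse `injectiveResolutionPlusFunctor`
  ("`U`: choose an injective resolution") with the compatible `CommShift` (`Equivalence.commShiftInverse`).
* §2 **`Functor.rightDerivedFunctorPlusModelIso`**: `K⁺(Inj) ⋙ q ⋙ RF ≅ K⁺(ι ⋙ F) ⋙ q` (the unit is an iso on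
  injectives); **`Functor.rightDerivedFunctorPlusIso : RF ≅ U ⋙ K⁺(ι ⋙ F) ⋙ q`** — verbatim Weibel's proof of the
  Existence Theorem 10.5.6 ("define `RF` to be the composite `qFU`"); hence
  **`Functor.commShiftRightDerivedFunctorPlus : RF.CommShift ℤ`** by transport of structure
  (`Functor.CommShift.ofIso`) — `RF` commutes with translation, as a morphism of triangulated categories must
  (Def. 10.5.1); and **`Functor.rightDerivedFunctorPlusObjIso`**: `RF(Q E•) ≅ Q(F I•)` for any quasi-isomorphism
  `E• ⟶ I•` into a bounded-below complex of injectives ("`R⁺F(I) ≅ qF(I)`").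
* §3 for an EXACT functor `G` ("Exact Functors 10.5.2: `F` preserves quasi-isomorphisms, hence extends trivially
  to `D(A) → D(B)`"): **`Functor.mapDerivedCategoryPlus : D⁺(C) ⥤ D⁺(D)`**, the restriction of Mathlib's
  `G.mapDerivedCategory` to `D⁺` (exact functors preserve "cohomologically `≥ n`",
  `isGE_mapDerivedCategory_obj`), its `CommShift ℤ` (`commShiftMapDerivedCategoryPlus`), and the factorisations
  `q ⋙ D⁺(G) ≅ K⁺(G) ⋙ q` (`mapDerivedCategoryPlusFactorsh`) and `Q ⋙ D⁺(G) ≅ C⁺(G) ⋙ Q`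
  (`mapDerivedCategoryPlusFactors`: `D⁺(G)(Q E•) ≅ Q(G E•)`, computed termwise).

Not here (recorded): the triangulated structure on `RF` beyond `CommShift` (compatibility of the transported
`CommShift` with the unit, `IsTriangulated`); `RF` on unbounded complexes (K-injective resolutions); composition
`R(G ∘ F) ≅ RG ∘ RF`. Typed for the cell `pub-hodge-ring2` (brick (1b-α) of the (M1) library debt of crux
26512: `Rf_*` on `D⁺(Mod 𝒪_X)` for a non-affine morphism, file `AlgebraicGeometry/Modules/DerivedPushforward`);
a research route conditional on HC_CM, not a corollary — nothing in this file refers to it.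

## References

* C. A. Weibel, *An introduction to homological algebra*, Cambridge (1994): Thm. 10.4.8 (`D⁺(A) ≅ K⁺(I)`),
  Def. 10.5.1 (total right derived functor = morphism of triangulated categories `D → D(B)` with universal `ξ`),
  10.5.2 (exact functors), Example 10.5.3, Existence Theorem 10.5.6 (`RF := qFU`, `R⁺F(I) ≅ qF(I)`),
  Cor. 10.5.7. [Weibel1994]
* R. Hartshorne, *Algebraic Geometry*, GTM 52 (1977), III §1 (derived functors, Thm. 1.1A; injective
  resolutions of complexes). [Hartshorne1977]
-/

noncomputable section

open CategoryTheory CategoryTheory.Limits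

universe w w' v v' u u'

namespace CategoryTheory

variable (C : Type u) [Category.{v} C] [Abelian C] [HasDerivedCategory.{w} C]
  {D : Type u'} [Category.{v'} D] [Abelian D] [HasDerivedCategory.{w'} D]

namespace InjectiveObject

/-! ### The injective model `K⁺(Inj C) ⥤ D⁺(C)` -/

/-- The **injective model** of the bounded-below derived category: the composite
`K⁺(Inj C) ⥤ K⁺(C) ⥤ D⁺(C)` of the functor induced by the inclusion of injective objects on bounded-below
homotopy categories with the localisation functor. [cite: Weibel1994, Thm. 10.4.8] -/
def derivedPlusModel : HomotopyCategory.Plus (InjectiveObject C) ⥤ DerivedCategory.Plus C :=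
  (InjectiveObject.ι C).mapHomotopyCategoryPlus ⋙ DerivedCategory.Plus.Qh

/-- Unfolding of the injective model. [cite: Weibel1994, Thm. 10.4.8] -/
theorem derivedPlusModel_def :
    derivedPlusModel C = (InjectiveObject.ι C).mapHomotopyCategoryPlus ⋙ DerivedCategory.Plus.Qh := rfl

variable {C} in
omit [HasDerivedCategory C] in
/-- A bounded-below complex of injective objects, read in `K⁺(C)`, is K-injective.
[cite: Weibel1994, Lemma 10.4.6 and Cor. 10.4.7] -/
theorem isKInjective_mapHomotopyCategoryPlus_obj (L : HomotopyCategory.Plus (InjectiveObject C)) :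
    CochainComplex.IsKInjective (((InjectiveObject.ι C).mapHomotopyCategoryPlus.obj L).obj.as) := by
  obtain ⟨K, rfl⟩ := HomotopyCategory.Plus.quotient_obj_surjective L
  exact inferInstanceAs (CochainComplex.IsKInjective
    (((InjectiveObject.ι C).mapHomologicalComplex (.up ℤ)).obj K.obj))

/-- The injective model is faithful (`Hom_{K⁺}(I, J) → Hom_{D⁺}(I, J)` is injective for `J` a bounded-below
complex of injectives). [cite: Weibel1994, Thm. 10.4.8] -/
theorem faithful_derivedPlusModel : (derivedPlusModel C).Faithful where
  map_injective {K L} f g h := by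
    have hb := DerivedCategory.Plus.Qh_map_bijective_of_isKInjective
      ((InjectiveObject.ι C).mapHomotopyCategoryPlus.obj K)
      ((InjectiveObject.ι C).mapHomotopyCategoryPlus.obj L) (isKInjective_mapHomotopyCategoryPlus_obj L)
    exact (InjectiveObject.ι C).mapHomotopyCategoryPlus.map_injective (hb.1 h)

/-- The injective model is full (`Hom_{K⁺}(I, J) → Hom_{D⁺}(I, J)` is surjective for `J` a bounded-below
complex of injectives). [cite: Weibel1994, Thm. 10.4.8] -/
theorem full_derivedPlusModel : (derivedPlusModel C).Full where
  map_surjective {K L} g := by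
    have hb := DerivedCategory.Plus.Qh_map_bijective_of_isKInjective
      ((InjectiveObject.ι C).mapHomotopyCategoryPlus.obj K)
      ((InjectiveObject.ι C).mapHomotopyCategoryPlus.obj L) (isKInjective_mapHomotopyCategoryPlus_obj L)
    obtain ⟨g', hg'⟩ := hb.2 g
    exact ⟨(InjectiveObject.ι C).mapHomotopyCategoryPlus.preimage g', by
      simp only [derivedPlusModel, Functor.comp_map, Functor.map_preimage, hg']⟩

variable [EnoughInjectives C]

/-- The injective model is essentially surjective when `C` has enough injectives (every bounded-below
complex has an injective resolution). [cite: Weibel1994, Thm. 10.4.8 (proof: injective resolutions 5.7.2)] -/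
theorem essSurj_derivedPlusModel : (derivedPlusModel C).EssSurj :=
  inferInstanceAs (((InjectiveObject.ι C).mapHomotopyCategoryPlus ⋙ DerivedCategory.Plus.Qh).EssSurj)

/-- **`K⁺(Inj C) ⥤ D⁺(C)` is an equivalence of categories** when `C` has enough injectives.
[cite: Weibel1994, Thm. 10.4.8] -/
theorem isEquivalence_derivedPlusModel : (derivedPlusModel C).IsEquivalence :=
  haveI := faithful_derivedPlusModel C
  haveI := full_derivedPlusModel C
  haveI := essSurj_derivedPlusModel C
  {}

omit [EnoughInjectives C] in
/-- The injective model commutes with the shifts (composite of two shift-commuting functors).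
[cite: Weibel1994, Thm. 10.4.8] -/
@[implicit_reducible]
def commShiftDerivedPlusModel : (derivedPlusModel C).CommShift ℤ :=
  inferInstanceAs (((InjectiveObject.ι C).mapHomotopyCategoryPlus ⋙ DerivedCategory.Plus.Qh).CommShift ℤ)

/-- The injective model as an equivalence of categories `K⁺(Inj C) ≌ D⁺(C)`.
[cite: Weibel1994, Thm. 10.4.8] -/
def derivedPlusModelEquivalence : HomotopyCategory.Plus (InjectiveObject C) ≌ DerivedCategory.Plus C :=
  haveI := isEquivalence_derivedPlusModel C
  (derivedPlusModel C).asEquivalence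

/-- The functor of `derivedPlusModelEquivalence` is the injective model. [cite: Weibel1994, Thm. 10.4.8] -/
theorem derivedPlusModelEquivalence_functor :
    (derivedPlusModelEquivalence C).functor = derivedPlusModel C := rfl

/-- The chosen quasi-inverse `D⁺(C) ⥤ K⁺(Inj C)` of the injective model ("choose an injective
resolution"). [cite: Weibel1994, Thm. 10.4.8 (proof: injective resolutions 5.7.2)] -/
def injectiveResolutionPlusFunctor : DerivedCategory.Plus C ⥤ HomotopyCategory.Plus (InjectiveObject C) :=
  (derivedPlusModelEquivalence C).inverse

/-- The resolution functor commutes with the shifts (the unique structure compatible with the one on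
the injective model). [cite: Weibel1994, Thm. 10.4.8] -/
@[implicit_reducible]
def commShiftInjectiveResolutionPlusFunctor : (injectiveResolutionPlusFunctor C).CommShift ℤ :=
  letI : (derivedPlusModelEquivalence C).functor.CommShift ℤ := commShiftDerivedPlusModel C
  (derivedPlusModelEquivalence C).commShiftInverse ℤ

end InjectiveObject

namespace Functor

open InjectiveObject

variable {C} (F : C ⥤ D) [F.Additive]

/-! ### The right derived functor on the injective model -/

/-- The unit of the right derived functor `RF` is an isomorphism on every bounded-below complex of
injectives: `F(I•) ⥲ RF(I•)` in `D⁺(D)`. [cite: Weibel1994, Existence Thm. 10.5.6] -/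
theorem isIso_rightDerivedFunctorPlusUnit_app [EnoughInjectives C] (K : HomotopyCategory.Plus C)
    [∀ n : ℤ, Injective (K.obj.as.X n)] : IsIso (F.rightDerivedFunctorPlusUnit.app K) :=
  inferInstance

variable [EnoughInjectives C]

/-- **`RF` restricted to the injective model is `F` applied termwise**:
`K⁺(Inj C) ⥤ D⁺(C) ⥤[RF] D⁺(D)` is isomorphic to `K⁺(Inj C) ⥤[F] K⁺(D) ⥤ D⁺(D)` (the unit of `RF`,
an isomorphism on complexes of injectives). [cite: Weibel1994, Existence Thm. 10.5.6 and Example 10.5.3] -/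
def rightDerivedFunctorPlusModelIso :
    derivedPlusModel C ⋙ F.rightDerivedFunctorPlus ≅
      (InjectiveObject.ι C ⋙ F).mapHomotopyCategoryPlus ⋙ DerivedCategory.Plus.Qh :=
  haveI : ∀ X, IsIso
      ((whiskerLeft (InjectiveObject.ι C).mapHomotopyCategoryPlus F.rightDerivedFunctorPlusUnit).app X) :=
    fun X => F.isIso_rightDerivedFunctorPlusUnit_app ((InjectiveObject.ι C).mapHomotopyCategoryPlus.obj X)
  haveI : IsIso (whiskerLeft (InjectiveObject.ι C).mapHomotopyCategoryPlus F.rightDerivedFunctorPlusUnit) :=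
    NatIso.isIso_of_isIso_app _
  (Functor.associator (InjectiveObject.ι C).mapHomotopyCategoryPlus DerivedCategory.Plus.Qh
      F.rightDerivedFunctorPlus : derivedPlusModel C ⋙ F.rightDerivedFunctorPlus ≅ _) ≪≫
    (asIso (whiskerLeft (InjectiveObject.ι C).mapHomotopyCategoryPlus F.rightDerivedFunctorPlusUnit)).symm ≪≫
    (Functor.associator _ _ _).symm ≪≫
    isoWhiskerRight (Functor.mapHomotopyCategoryPlusCompIso (Iso.refl (InjectiveObject.ι C ⋙ F))) _

/-- **`RF ≅ (resolve) ⋙ F ⋙ (localise)`**: the right derived functor on `D⁺(C)` is the composite of the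
chosen injective-resolution functor `D⁺(C) ⥤ K⁺(Inj C)`, the termwise functor `K⁺(Inj C) ⥤ K⁺(D)` and the
localisation `K⁺(D) ⥤ D⁺(D)`. [cite: Weibel1994, Existence Thm. 10.5.6] -/
def rightDerivedFunctorPlusIso :
    F.rightDerivedFunctorPlus ≅ injectiveResolutionPlusFunctor C ⋙
      (InjectiveObject.ι C ⋙ F).mapHomotopyCategoryPlus ⋙ DerivedCategory.Plus.Qh :=
  F.rightDerivedFunctorPlus.leftUnitor.symm ≪≫
    isoWhiskerRight (derivedPlusModelEquivalence C).counitIso.symm _ ≪≫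
    Functor.associator _ _ _ ≪≫ isoWhiskerLeft _ F.rightDerivedFunctorPlusModelIso

/-- **The right derived functor `RF : D⁺(C) ⥤ D⁺(D)` commutes with the shifts**, by transport of
structure along `rightDerivedFunctorPlusIso` (every factor of the model commutes with the shifts).
[cite: Weibel1994, Def. 10.5.1 and Existence Thm. 10.5.6 (RF = qFU is a morphism of triangulated categories)] -/
@[implicit_reducible]
def commShiftRightDerivedFunctorPlus : F.rightDerivedFunctorPlus.CommShift ℤ :=
  letI := commShiftInjectiveResolutionPlusFunctor C
  letI : (injectiveResolutionPlusFunctor C ⋙ (InjectiveObject.ι C ⋙ F).mapHomotopyCategoryPlus ⋙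
      DerivedCategory.Plus.Qh).CommShift ℤ := inferInstance
  Functor.CommShift.ofIso F.rightDerivedFunctorPlusIso.symm ℤ

/-! ### `RF` is computed on injective resolutions -/

omit [EnoughInjectives C] in
/-- The localisation functor `Q : C⁺(C) ⥤ D⁺(C)` inverts quasi-isomorphisms. [cite: Weibel1994, §10.4 (10.4.1: D is the localisation of K at quasi-isomorphisms)] -/
theorem isIso_Q_map_of_quasiIso {K L : CochainComplex.Plus C} (φ : K ⟶ L) [QuasiIso φ.hom] :
    IsIso (DerivedCategory.Plus.Q.map φ) := by
  have h : HomotopyCategory.Plus.quasiIso C ((HomotopyCategory.Plus.quotient C).map φ) := by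
    rw [HomotopyCategory.Plus.quasiIso_iff]
    exact (HomotopyCategory.quotient_map_mem_quasiIso_iff φ.hom).mpr
      ((HomologicalComplex.mem_quasiIso_iff φ.hom).mpr inferInstance)
  exact Localization.inverts DerivedCategory.Plus.Qh (HomotopyCategory.Plus.quasiIso C) _ h

/-- **`RF(E•) ≅ F(I•)` for an injective resolution `E• ⥲ I•`**: if `ι : E• ⟶ I•` is a quasi-isomorphism
of bounded-below complexes with `Iⁿ` injective for all `n`, then `RF(Q E•) ≅ Q(F I•)` in `D⁺(D)`.
[cite: Weibel1994, Existence Thm. 10.5.6 (R⁺F(I) ≅ qF(I))] -/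
def rightDerivedFunctorPlusObjIso {K I : CochainComplex.Plus C} (ι : K ⟶ I) [QuasiIso ι.hom]
    [∀ n : ℤ, Injective (I.obj.X n)] :
    F.rightDerivedFunctorPlus.obj (DerivedCategory.Plus.Q.obj K) ≅
      DerivedCategory.Plus.Q.obj (F.mapCochainComplexPlus.obj I) :=
  haveI := isIso_Q_map_of_quasiIso (C := C) ι
  haveI := F.isIso_rightDerivedFunctorPlusUnit_app ((HomotopyCategory.Plus.quotient C).obj I)
  F.rightDerivedFunctorPlus.mapIso (asIso (DerivedCategory.Plus.Q.map ι)) ≪≫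
    (asIso (F.rightDerivedFunctorPlusUnit.app ((HomotopyCategory.Plus.quotient C).obj I))).symm

/-! ### Exact functors on the bounded-below derived category -/

section Exact

variable (G : C ⥤ D) [G.Additive] [PreservesFiniteLimits G] [PreservesFiniteColimits G]

omit [EnoughInjectives C] in
/-- An exact functor preserves the condition "cohomologically in degrees `≥ n`": if `X ∈ D(C)` is `≥ n` then so
is `G(X) ∈ D(D)` (exact functors commute with cohomology). [cite: Weibel1994, Exact Functors 10.5.2] -/
theorem isGE_mapDerivedCategory_obj (X : DerivedCategory C) (n : ℤ) [X.IsGE n] :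
    (G.mapDerivedCategory.obj X).IsGE n := by
  obtain ⟨K, hK, ⟨e⟩⟩ := X.exists_iso_Q_obj_of_isGE n
  haveI : CochainComplex.IsStrictlyGE ((G.mapHomologicalComplex (ComplexShape.up ℤ)).obj K) n := inferInstance
  have e' : DerivedCategory.Q.obj ((G.mapHomologicalComplex (ComplexShape.up ℤ)).obj K) ≅ G.mapDerivedCategory.obj X :=
    (G.mapDerivedCategory.mapIso e ≪≫ G.mapDerivedCategoryFactors.app K).symm
  exact DerivedCategory.TStructure.t.isGE_of_iso e' n

omit [EnoughInjectives C] in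
/-- **The functor `D⁺(C) ⥤ D⁺(D)` induced by an EXACT functor `G : C ⥤ D`**: the restriction of Mathlib's
`G.mapDerivedCategory : D(C) ⥤ D(D)` (the localisation of the termwise functor, no resolutions) to the
bounded-below derived categories. [cite: Weibel1994, Exact Functors 10.5.2] -/
def mapDerivedCategoryPlus : DerivedCategory.Plus C ⥤ DerivedCategory.Plus D :=
  DerivedCategory.TStructure.t.plus.lift (DerivedCategory.Plus.ι ⋙ G.mapDerivedCategory) (fun X => by
    obtain ⟨n, hn⟩ := X.property
    exact ⟨n, G.isGE_mapDerivedCategory_obj X.obj n⟩)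

omit [EnoughInjectives C] in
/-- `G.mapDerivedCategoryPlus` IS `G.mapDerivedCategory` on underlying objects of `D(C)`.
[cite: Weibel1994, Exact Functors 10.5.2] -/
def mapDerivedCategoryPlusCompιIso :
    G.mapDerivedCategoryPlus ⋙ DerivedCategory.Plus.ι ≅ DerivedCategory.Plus.ι ⋙ G.mapDerivedCategory :=
  Iso.refl _

omit [EnoughInjectives C] in
/-- The functor `D⁺(C) ⥤ D⁺(D)` of an exact functor commutes with the shifts (restriction of the structure on
`G.mapDerivedCategory` to the shift-stable subcategory `D⁺`). A `def`, not an instance (use `letI`).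
[cite: Weibel1994, Exact Functors 10.5.2] -/
@[implicit_reducible]
def commShiftMapDerivedCategoryPlus : G.mapDerivedCategoryPlus.CommShift ℤ := by
  dsimp only [mapDerivedCategoryPlus]
  infer_instance

omit [EnoughInjectives C] in
/-- **Factorisation through the homotopy categories**: `q ∘ K⁺(G) ≅ D⁺(G) ∘ q` on `K⁺(C)`
(`q = Qh : K⁺ ⥤ D⁺`). [cite: Weibel1994, Exact Functors 10.5.2] -/
def mapDerivedCategoryPlusFactorsh :
    DerivedCategory.Plus.Qh ⋙ G.mapDerivedCategoryPlus ≅ G.mapHomotopyCategoryPlus ⋙ DerivedCategory.Plus.Qh :=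
  ((DerivedCategory.TStructure.t (C := D)).plus.fullyFaithfulι.whiskeringRight
      (HomotopyCategory.Plus C)).preimageIso
    (isoWhiskerLeft (HomotopyCategory.Plus.ι C) G.mapDerivedCategoryFactorsh)

omit [EnoughInjectives C] in
/-- **Factorisation through the categories of complexes**: `Q ∘ C⁺(G) ≅ D⁺(G) ∘ Q` on `C⁺(C)`, i.e.
`D⁺(G)(Q E•) ≅ Q(G E•)` naturally in the bounded-below complex `E•` — an exact functor is computed termwise,
no resolution needed. [cite: Weibel1994, Exact Functors 10.5.2] -/
def mapDerivedCategoryPlusFactors :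
    DerivedCategory.Plus.Q ⋙ G.mapDerivedCategoryPlus ≅ G.mapCochainComplexPlus ⋙ DerivedCategory.Plus.Q :=
  Functor.associator _ _ _ ≪≫
    isoWhiskerLeft (HomotopyCategory.Plus.quotient C) G.mapDerivedCategoryPlusFactorsh ≪≫
    (Functor.associator _ _ _).symm ≪≫
    isoWhiskerRight (Iso.refl _ : HomotopyCategory.Plus.quotient C ⋙ G.mapHomotopyCategoryPlus ≅
      G.mapCochainComplexPlus ⋙ HomotopyCategory.Plus.quotient D) _ ≪≫
    Functor.associator _ _ _

end Exact

end Functor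

end CategoryTheory

end
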